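import Literature.Combinatorics.Optimization.CompletelyPsdRank
import HarnessLib

/-!
# Cpsd-graphs: PSVW Theorem 17 made quantitative, Remark 6.2 and Theorem 18 (Prakash–Sikora–Varvitsiotis–Wei 2017, §6)

Source: A. Prakash, J. Sikora, A. Varvitsiotis, Z. Wei, *Completely positive semidefinite rank*,
Math. Program. 171 (2018) 397–431 = arXiv:1604.07199 [PrakashEtAl2017], §6 "cpsd-graphs" (held text
`paper:arxiv-1604.07199`, chunks p20–p21; numbering of the arXiv version). Companion of
`CompletelyPsdRank.lean` (same directory), which holds the vocabulary (`HasCpsdFactorization`, `IsCpsd`,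
`IsCp`, `IsDnn`), the NAMED FACT `PrakashEtAl2017_thm18` (Theorem 18: "A graph is cpsd if and only if
it has no `C_{2t+1}`-subgraph (`t ≥ 2`)"), the exact `M_d(ℂ)` case of Theorem 17
(`HasCpsdFactorization.exists_row_eq_mul_row`) and the discharge of Lemma 11
(`PrakashEtAl2017_lemma11_holds`: `A_t − λ_t I ∈ DNN \ CS_+`). This file is a separate module only
because the companion has reached the gate's file-size limit.

The printed route to Theorem 18's "only if" direction is: Lemma 11 (`A_t − λ_t I` has no
`𝒩⁺`-factorization in ANY tracial von Neumann algebra, by Theorem 17) ⇒ Remark 6.2 (`A_t − λ_t I ∉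
cl(CS_+)`, invoking [BLP] = Burgdorf–Laurent–Piovesan: every point of the closure has an
`𝒩⁺`-factorization) ⇒ the perturbation `X_a = X̃ + aI + bA_G` (Proof 20, p21). Mathlib has no von
Neumann algebras; here the middle step is replaced by a QUANTITATIVE version of Theorem 17 inside
`M_d(ℂ)`, uniform in `d` (`exists_gap_of_kernel_config`): the printed algebra (Remark 6.1;
"`τ(pq) = 0 ⇒ pq = 0`"; uniqueness of positive square roots) is run with explicit errors, the last step
through the Powers–Størmer inequality `‖s − t‖₂² ≤ Tr(W(s² − t²))` for the sign `W` of `s − t`.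

Contents (everything PROVED; no new definitions or named facts):
* `exists_gap_of_kernel_config` — Theorem 17 / Remark 6.2, quantitative finite-dimensional form: under
  the Gram-free hypotheses of `HasCpsdFactorization.exists_row_eq_mul_row` plus "rows `i*, j*` not
  parallel", some `δ > 0` separates `X` entrywise from every cpsd matrix of every size.
* `PrakashEtAl2017_rem62` — Remark 6.2: `A_t − λ_t I ∉ closure(CS_+^{2t+1})` (`t ≥ 2`).
* `PrakashEtAl2017_thm18_mp`, `PrakashEtAl2017_thm18_mp'` — Theorem 18, direction "⇒": a graph with a
  `C_{2t+1}`-subgraph (`t ≥ 2`) carries a doubly nonnegative matrix with support exactly the graph that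
  is not cpsd.
* `PrakashEtAl2017_thm18_of_cpGraphs` — Theorem 18 from its printed "⇐" input, Kogan–Berman's
  characterisation of completely positive graphs [KB] (N. Kogan, A. Berman, Discrete Math. 114 (1993)
  297–304; not in the tree), supplied as a hypothesis: with it the typed fact `PrakashEtAl2017_thm18`
  follows.
* private toolkit: trace Cauchy–Schwarz `|Tr(AB)| ≤ ‖A‖₂‖B‖₂`, isometry invariance of `‖·‖₂`,
  `|Tr(W P Q)|² ≤ ‖P‖₂‖Q‖₂ Tr(PQ)` for psd `P, Q`, the sign decomposition of a Hermitian matrix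
  (spectral theorem) and the Powers–Størmer inequality; the kernel vectors `k ↦ sin(θk + φ)` of
  `A(C_n) − 2cos θ·I` (copies of the companion's private lemmas).
-/

noncomputable section

open Matrix Finset
open scoped MatrixOrder ComplexOrder

namespace Literature.Combinatorics.Optimization

section RobustThm17

open Real

/-! #### Trace pairing toolkit: `Σ|A_kl|²`, Cauchy–Schwarz, unitary invariance -/

/-- `Tr(Aᴴ A) = Σ_{k,l} |A_kl|²`. [folklore] -/
private theorem trace_conjTranspose_mul_self_eq_sum {p q : Type*} [Fintype p] [Fintype q]
    (A : Matrix p q ℂ) : (Aᴴ * A).trace = ((∑ k, ∑ l, ‖A k l‖ ^ 2 : ℝ) : ℂ) := by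
  simp only [Matrix.trace, Matrix.diag_apply, Matrix.mul_apply, Matrix.conjTranspose_apply]
  push_cast
  rw [Finset.sum_comm]
  refine sum_congr rfl fun k _ => sum_congr rfl fun l _ => ?_
  rw [Complex.star_def, Complex.conj_mul']

/-- **Cauchy–Schwarz for the trace pairing**: `|Tr(AB)| ≤ (Σ|A_kl|²)^{1/2} (Σ|B_kl|²)^{1/2}`. [folklore] -/
private theorem norm_trace_mul_le {p q : Type*} [Fintype p] [Fintype q] (A : Matrix p q ℂ)
    (B : Matrix q p ℂ) :
    ‖(A * B).trace‖ ≤ Real.sqrt (∑ k, ∑ l, ‖A k l‖ ^ 2) * Real.sqrt (∑ k, ∑ l, ‖B k l‖ ^ 2) := by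
  have h1 : ‖(A * B).trace‖ ≤ ∑ k, ∑ l, ‖A k l‖ * ‖B l k‖ := by
    simp only [Matrix.trace, Matrix.diag_apply, Matrix.mul_apply]
    refine (norm_sum_le _ _).trans (sum_le_sum fun k _ => (norm_sum_le _ _).trans
      (sum_le_sum fun l _ => ?_))
    rw [norm_mul]
  have h2 : (∑ k, ∑ l, ‖A k l‖ * ‖B l k‖) ^ 2 ≤
      (∑ k, ∑ l, ‖A k l‖ ^ 2) * (∑ k, ∑ l, ‖B k l‖ ^ 2) := by
    have h := Finset.sum_mul_sq_le_sq_mul_sq (Finset.univ : Finset (p × q))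
      (fun kl => ‖A kl.1 kl.2‖) (fun kl => ‖B kl.2 kl.1‖)
    simp only [Fintype.sum_prod_type] at h
    have hB : ∑ k : p, ∑ l : q, ‖B l k‖ ^ 2 = ∑ k : q, ∑ l : p, ‖B k l‖ ^ 2 := Finset.sum_comm
    rw [hB] at h
    exact h
  have hA : 0 ≤ ∑ k, ∑ l, ‖A k l‖ ^ 2 := by positivity
  have h0 : 0 ≤ ∑ k, ∑ l, ‖A k l‖ * ‖B l k‖ := by positivity
  calc ‖(A * B).trace‖ ≤ ∑ k, ∑ l, ‖A k l‖ * ‖B l k‖ := h1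
    _ = Real.sqrt ((∑ k, ∑ l, ‖A k l‖ * ‖B l k‖) ^ 2) := (Real.sqrt_sq h0).symm
    _ ≤ Real.sqrt ((∑ k, ∑ l, ‖A k l‖ ^ 2) * (∑ k, ∑ l, ‖B k l‖ ^ 2)) := Real.sqrt_le_sqrt h2
    _ = Real.sqrt (∑ k, ∑ l, ‖A k l‖ ^ 2) * Real.sqrt (∑ k, ∑ l, ‖B k l‖ ^ 2) :=
        Real.sqrt_mul hA _

/-- `Σ|(WP)_kl|² = Σ|P_kl|²` for an isometry `W` (`WᴴW = 1`). [folklore] -/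
private theorem sum_norm_sq_isometry_mul {p : Type*} [Fintype p] [DecidableEq p] {W : Matrix p p ℂ}
    (hW : Wᴴ * W = 1) (P : Matrix p p ℂ) :
    ∑ k, ∑ l, ‖(W * P) k l‖ ^ 2 = ∑ k, ∑ l, ‖P k l‖ ^ 2 := by
  have h := trace_conjTranspose_mul_self_eq_sum (W * P)
  rw [conjTranspose_mul, Matrix.mul_assoc, ← Matrix.mul_assoc Wᴴ, hW, Matrix.one_mul,
    trace_conjTranspose_mul_self_eq_sum] at h
  exact_mod_cast h.symm

/-- `Σ|(PW)_kl|² = Σ|P_kl|²` for a co-isometry `W` (`WWᴴ = 1`). [folklore] -/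
private theorem sum_norm_sq_mul_coisometry {p : Type*} [Fintype p] [DecidableEq p] {W : Matrix p p ℂ}
    (hW : W * Wᴴ = 1) (P : Matrix p p ℂ) :
    ∑ k, ∑ l, ‖(P * W) k l‖ ^ 2 = ∑ k, ∑ l, ‖P k l‖ ^ 2 := by
  have h := trace_conjTranspose_mul_self_eq_sum (P * W)
  rw [conjTranspose_mul, Matrix.mul_assoc, trace_mul_comm, Matrix.mul_assoc, Matrix.mul_assoc, hW,
    Matrix.mul_one, trace_conjTranspose_mul_self_eq_sum] at h
  exact_mod_cast h.symm

/-- For Hermitian `P`: `Tr(P²) = Σ|P_kl|²`. [folklore] -/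
private theorem trace_mul_self_eq_sum_of_isHermitian {p : Type*} [Fintype p] {P : Matrix p p ℂ}
    (hP : P.IsHermitian) : (P * P).trace = ((∑ k, ∑ l, ‖P k l‖ ^ 2 : ℝ) : ℂ) := by
  have h := trace_conjTranspose_mul_self_eq_sum P
  rwa [hP.eq] at h

/-- `Tr(PQ) ≥ 0` for psd `P, Q` (as in PSVW Lemma 1: write `Q = CᴴC`, then `Tr(P CᴴC) = Σ_l c̄_lᵀ P c_l`).
[cite: PrakashEtAl2017, Lemma 1 (ii) (p08)] -/
private theorem trace_mul_nonneg_complex' {p : Type*} [Fintype p] [DecidableEq p]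
    {P Q : Matrix p p ℂ} (hP : P.PosSemidef) (hQ : Q.PosSemidef) : 0 ≤ (P * Q).trace := by
  classical
  obtain ⟨C, hC⟩ := CStarAlgebra.nonneg_iff_eq_star_mul_self.mp hQ.nonneg
  have hQC : Q = Cᴴ * C := by rw [hC, star_eq_conjTranspose]
  have hsum : (P * Q).trace = ∑ l, star (star (C l)) ⬝ᵥ (P *ᵥ star (C l)) := by
    rw [hQC, ← Matrix.mul_assoc, Matrix.trace_mul_comm]
    simp only [Matrix.trace, Matrix.diag_apply, Matrix.mul_apply, Matrix.conjTranspose_apply,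
      dotProduct, Matrix.mulVec, Finset.mul_sum, star_star, Pi.star_apply]
  rw [hsum]
  exact sum_nonneg fun l _ => hP.dotProduct_mulVec_nonneg _

/-- **Quantitative orthogonality**: for psd `P, Q` and `W` with `WWᴴ = 1`,
`|Tr(W P Q)|² ≤ (Tr P² · Tr Q²)^{1/2} · Tr(PQ)` — the robust form of "`Tr(pq) = 0 ⇒ pq = 0`" used in the
proof of Theorem 17 (write `P = CᴴC`, `Q = DᴴD`, `Tr(W CᴴC DᴴD) = Tr((D W Cᴴ)(C Dᴴ))`, Cauchy–Schwarz,
and `‖C Dᴴ‖² = Tr(PQ)`, `‖D W Cᴴ‖² = Tr(Wᴴ Q W P) ≤ ‖Q‖‖P‖`). [cite: PrakashEtAl2017, Remark 6.1 / Thm. 17 proof (p20)] -/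
private theorem norm_trace_unitary_mul_mul_sq_le {p : Type*} [Fintype p] [DecidableEq p]
    {P Q W : Matrix p p ℂ} (hP : P.PosSemidef) (hQ : Q.PosSemidef) (hW2 : W * Wᴴ = 1) :
    ‖(W * (P * Q)).trace‖ ^ 2 ≤
      Real.sqrt ((P * P).trace.re * (Q * Q).trace.re) * (P * Q).trace.re := by
  classical
  obtain ⟨C, hC⟩ := CStarAlgebra.nonneg_iff_eq_star_mul_self.mp hP.nonneg
  obtain ⟨D, hD⟩ := CStarAlgebra.nonneg_iff_eq_star_mul_self.mp hQ.nonneg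
  have hPC : P = Cᴴ * C := by rw [hC, star_eq_conjTranspose]
  have hQD : Q = Dᴴ * D := by rw [hD, star_eq_conjTranspose]
  -- `Tr(W P Q) = Tr((D W Cᴴ)(C Dᴴ))`
  have hcyc : (W * (P * Q)).trace = ((D * W * Cᴴ) * (C * Dᴴ)).trace := by
    rw [hPC, hQD, show W * (Cᴴ * C * (Dᴴ * D)) = (W * Cᴴ * C * Dᴴ) * D by
      simp only [Matrix.mul_assoc], trace_mul_comm]
    simp only [Matrix.mul_assoc]
  -- the two Frobenius quantities
  have hF1 : ∑ k, ∑ l, ‖(C * Dᴴ) k l‖ ^ 2 = (P * Q).trace.re := by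
    have h := trace_conjTranspose_mul_self_eq_sum (C * Dᴴ)
    rw [conjTranspose_mul, conjTranspose_conjTranspose,
      show D * Cᴴ * (C * Dᴴ) = D * (Cᴴ * C * Dᴴ) by simp only [Matrix.mul_assoc], trace_mul_comm,
      show Cᴴ * C * Dᴴ * D = P * Q by rw [hPC, hQD, Matrix.mul_assoc]] at h
    rw [h, Complex.ofReal_re]
  have hF2 : ∑ k, ∑ l, ‖(D * W * Cᴴ) k l‖ ^ 2 ≤ Real.sqrt ((P * P).trace.re * (Q * Q).trace.re) := by
    have h := trace_conjTranspose_mul_self_eq_sum (D * W * Cᴴ)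
    rw [conjTranspose_mul, conjTranspose_mul, conjTranspose_conjTranspose,
      show C * (Wᴴ * Dᴴ) * (D * W * Cᴴ) = C * (Wᴴ * (Dᴴ * D) * W * Cᴴ) by simp only [Matrix.mul_assoc],
      trace_mul_comm, show Wᴴ * (Dᴴ * D) * W * Cᴴ * C = (Wᴴ * Q * W) * P by
        rw [hPC, hQD]; simp only [Matrix.mul_assoc]] at h
    -- `Σ|(DWCᴴ)_kl|² = Tr((WᴴQW) P) ≤ ‖WᴴQW‖ ‖P‖ = ‖Q‖ ‖P‖`
    have hre : ∑ k, ∑ l, ‖(D * W * Cᴴ) k l‖ ^ 2 = ((Wᴴ * Q * W) * P).trace.re := by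
      rw [h, Complex.ofReal_re]
    rw [hre]
    refine (Complex.re_le_norm _).trans ?_
    refine (norm_trace_mul_le _ _).trans ?_
    have hW1' : (Wᴴ)ᴴ * Wᴴ = 1 := by rw [conjTranspose_conjTranspose]; exact hW2
    rw [show Wᴴ * Q * W = Wᴴ * (Q * W) by rw [Matrix.mul_assoc], sum_norm_sq_isometry_mul hW1' (Q * W),
      sum_norm_sq_mul_coisometry hW2 Q]
    have h0 : 0 ≤ ∑ k, ∑ l, ‖Q k l‖ ^ 2 := by positivity
    rw [← Real.sqrt_mul h0, mul_comm]
    have hPP : (P * P).trace.re = ∑ k, ∑ l, ‖P k l‖ ^ 2 := by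
      rw [trace_mul_self_eq_sum_of_isHermitian hP.1, Complex.ofReal_re]
    have hQQ : (Q * Q).trace.re = ∑ k, ∑ l, ‖Q k l‖ ^ 2 := by
      rw [trace_mul_self_eq_sum_of_isHermitian hQ.1, Complex.ofReal_re]
    rw [hPP, hQQ]
  have hPQ : 0 ≤ (P * Q).trace.re := by
    have := trace_mul_nonneg_complex' hP hQ
    rw [Complex.le_def] at this
    simpa using this.1
  rw [hcyc]
  have h := norm_trace_mul_le (D * W * Cᴴ) (C * Dᴴ)
  have h0 : 0 ≤ ‖(D * W * Cᴴ * (C * Dᴴ)).trace‖ := norm_nonneg _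
  calc ‖(D * W * Cᴴ * (C * Dᴴ)).trace‖ ^ 2
      ≤ (Real.sqrt (∑ k, ∑ l, ‖(D * W * Cᴴ) k l‖ ^ 2) * Real.sqrt (∑ k, ∑ l, ‖(C * Dᴴ) k l‖ ^ 2)) ^ 2 :=
        pow_le_pow_left₀ h0 h 2
    _ = (∑ k, ∑ l, ‖(D * W * Cᴴ) k l‖ ^ 2) * (∑ k, ∑ l, ‖(C * Dᴴ) k l‖ ^ 2) := by
        rw [mul_pow, Real.sq_sqrt (by positivity), Real.sq_sqrt (by positivity)]
    _ ≤ Real.sqrt ((P * P).trace.re * (Q * Q).trace.re) * (P * Q).trace.re := by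
        rw [hF1]
        exact mul_le_mul_of_nonneg_right hF2 hPQ

/-! #### Sign decomposition of a Hermitian matrix and the Powers–Størmer inequality -/

/-- **Sign decomposition.** A Hermitian `D` splits as `D = D₊ − D₋` with `D₊, D₋ ⪰ 0`, and there is a
unitary `W` (the "sign" of `D`, `W = U diag(±1) Uᴴ`) with `WD = DW = D₊ + D₋`. [folklore] -/
private theorem exists_sign_decomposition {p : Type*} [Fintype p] [DecidableEq p]
    {D : Matrix p p ℂ} (hD : D.IsHermitian) :
    ∃ W Dp Dm : Matrix p p ℂ, Dp.PosSemidef ∧ Dm.PosSemidef ∧ D = Dp - Dm ∧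
      Wᴴ * W = 1 ∧ W * Wᴴ = 1 ∧ W * D = Dp + Dm ∧ D * W = Dp + Dm := by
  classical
  set U : Matrix p p ℂ := (hD.eigenvectorUnitary : Matrix p p ℂ) with hU
  have hUU : Uᴴ * U = 1 := by
    rw [← star_eq_conjTranspose]; exact Unitary.coe_star_mul_self hD.eigenvectorUnitary
  have hUU' : U * Uᴴ = 1 := by
    rw [← star_eq_conjTranspose]; exact Unitary.coe_mul_star_self hD.eigenvectorUnitary
  obtain ⟨lam, hlam⟩ : ∃ lam : p → ℝ, lam = hD.eigenvalues := ⟨_, rfl⟩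
  obtain ⟨Λ, hΛ⟩ : ∃ Λ : Matrix p p ℂ, Λ = diagonal fun k => ((lam k : ℝ) : ℂ) := ⟨_, rfl⟩
  have hDU : D * U = U * Λ := by
    ext k l
    have h := congrFun (hD.mulVec_eigenvectorBasis l) k
    simp only [Matrix.mulVec, dotProduct, Pi.smul_apply, Complex.real_smul] at h
    rw [hΛ, mul_diagonal, Matrix.mul_apply]
    simp only [hU, Matrix.IsHermitian.eigenvectorUnitary_apply]
    rw [h, mul_comm, hlam]
  have hDeq : D = U * Λ * Uᴴ := by rw [← hDU, Matrix.mul_assoc, hUU', Matrix.mul_one]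
  -- diagonal data: sign, positive part, negative part
  obtain ⟨σ, hσ⟩ : ∃ σ : p → ℝ, σ = fun k => if 0 ≤ lam k then 1 else -1 := ⟨_, rfl⟩
  obtain ⟨Sg, hSg⟩ : ∃ Sg : Matrix p p ℂ, Sg = diagonal fun k => ((σ k : ℝ) : ℂ) := ⟨_, rfl⟩
  obtain ⟨Λp, hΛp⟩ : ∃ Λp : Matrix p p ℂ, Λp = diagonal fun k => ((max (lam k) 0 : ℝ) : ℂ) := ⟨_, rfl⟩
  obtain ⟨Λm, hΛm⟩ : ∃ Λm : Matrix p p ℂ, Λm = diagonal fun k => ((max (-lam k) 0 : ℝ) : ℂ) :=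
    ⟨_, rfl⟩
  have hσσ : ∀ k, σ k * σ k = 1 := fun k => by
    rw [hσ]
    dsimp only
    split_ifs <;> norm_num
  have hσlam : ∀ k, σ k * lam k = max (lam k) 0 + max (-lam k) 0 := fun k => by
    rw [hσ]
    dsimp only
    split_ifs with h
    · rw [max_eq_left h, max_eq_right (by linarith), one_mul, add_zero]
    · push Not at h
      rw [max_eq_right h.le, max_eq_left (by linarith)]
      ring
  have hlampm : ∀ k, lam k = max (lam k) 0 - max (-lam k) 0 := fun k =>
    (max_zero_sub_max_neg_zero_eq_self (lam k)).symm
  -- conjugation algebra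
  have hconj : ∀ A B : Matrix p p ℂ, (U * A * Uᴴ) * (U * B * Uᴴ) = U * (A * B) * Uᴴ := fun A B => by
    rw [show U * A * Uᴴ * (U * B * Uᴴ) = U * A * (Uᴴ * U) * B * Uᴴ by simp only [Matrix.mul_assoc],
      hUU, Matrix.mul_one]
    simp only [Matrix.mul_assoc]
  have hSgH : Sgᴴ = Sg := by
    rw [hSg, diagonal_conjTranspose]
    congr 1
    ext k
    rw [Pi.star_apply, Complex.star_def, Complex.conj_ofReal]
  have hSgSg : Sg * Sg = 1 := by
    rw [hSg, diagonal_mul_diagonal, ← diagonal_one]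
    congr 1
    ext k
    rw [← Complex.ofReal_mul, hσσ, Complex.ofReal_one]
  have hSgΛ : Sg * Λ = Λp + Λm := by
    rw [hSg, hΛ, hΛp, hΛm, diagonal_mul_diagonal, diagonal_add]
    congr 1
    ext k
    rw [← Complex.ofReal_mul, hσlam, Complex.ofReal_add]
  have hΛSg : Λ * Sg = Λp + Λm := by
    rw [← hSgΛ, hSg, hΛ, diagonal_mul_diagonal, diagonal_mul_diagonal]
    congr 1
    ext k
    rw [mul_comm]
  have hΛpm : Λ = Λp - Λm := by
    rw [hΛ, hΛp, hΛm]
    ext k l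
    rw [Matrix.sub_apply, diagonal_apply, diagonal_apply, diagonal_apply]
    split_ifs
    · rw [← Complex.ofReal_sub, ← hlampm]
    · rw [sub_zero]
  refine ⟨U * Sg * Uᴴ, U * Λp * Uᴴ, U * Λm * Uᴴ, ?_, ?_, ?_, ?_, ?_, ?_, ?_⟩
  · rw [hΛp]
    exact PosSemidef.mul_mul_conjTranspose_same
      (posSemidef_diagonal_iff.mpr fun k => Complex.zero_le_real.mpr (le_max_right _ _)) U
  · rw [hΛm]
    exact PosSemidef.mul_mul_conjTranspose_same
      (posSemidef_diagonal_iff.mpr fun k => Complex.zero_le_real.mpr (le_max_right _ _)) U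
  · rw [hDeq, hΛpm, Matrix.mul_sub, Matrix.sub_mul]
  · rw [conjTranspose_mul, conjTranspose_mul, conjTranspose_conjTranspose, hSgH,
      show U * (Sg * Uᴴ) = U * Sg * Uᴴ by rw [Matrix.mul_assoc], hconj, hSgSg, Matrix.mul_one, hUU']
  · rw [conjTranspose_mul, conjTranspose_mul, conjTranspose_conjTranspose, hSgH,
      show U * (Sg * Uᴴ) = U * Sg * Uᴴ by rw [Matrix.mul_assoc], hconj, hSgSg, Matrix.mul_one, hUU']
  · rw [hDeq, hconj, hSgΛ, Matrix.mul_add, Matrix.add_mul]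
  · rw [hDeq, hconj, hΛSg, Matrix.mul_add, Matrix.add_mul]

/-- **Powers–Størmer inequality** (matrix case): for psd `s, t` there is a unitary `W` (the sign of
`s − t`) with `Tr((s−t)²) ≤ Re Tr(W(s² − t²))`; in particular `‖s − t‖₂² ≤ ‖s² − t²‖₁`. Proof:
`s² − t² = s(s−t) + (s−t)t`, `Tr(W s(s−t)) = Tr(|s−t| s)`, and `Tr(t (s−t)₊), Tr(s (s−t)₋) ≥ 0`.
[folklore] (R. T. Powers, E. Størmer, Comm. Math. Phys. 16 (1970), Lemma 4.1) -/
private theorem powers_stormer {p : Type*} [Fintype p] [DecidableEq p] {s t : Matrix p p ℂ}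
    (hs : s.PosSemidef) (ht : t.PosSemidef) :
    ∃ W : Matrix p p ℂ, Wᴴ * W = 1 ∧ W * Wᴴ = 1 ∧
      ((s - t) * (s - t)).trace.re ≤ (W * (s * s - t * t)).trace.re := by
  obtain ⟨W, Dp, Dm, hDp, hDm, hD, hW1, hW2, hWD, hDW⟩ := exists_sign_decomposition (hs.1.sub ht.1)
  refine ⟨W, hW1, hW2, ?_⟩
  have hsplit : s * s - t * t = s * (s - t) + (s - t) * t := by
    rw [Matrix.mul_sub, Matrix.sub_mul]
    abel
  have h1 : (W * (s * s - t * t)).trace = ((Dp + Dm) * s).trace + ((Dp + Dm) * t).trace := by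
    rw [hsplit, Matrix.mul_add, trace_add, ← Matrix.mul_assoc W s, trace_mul_cycle W s (s - t), hDW,
      ← Matrix.mul_assoc W (s - t) t, hWD]
  have h2 : ((s - t) * (s - t)).trace =
      ((Dp * s).trace - (Dm * s).trace) - ((Dp * t).trace - (Dm * t).trace) := by
    conv_lhs => rw [show (s - t) * (s - t) = (Dp - Dm) * (s - t) by rw [← hD]]
    rw [Matrix.mul_sub, Matrix.sub_mul, Matrix.sub_mul, trace_sub, trace_sub, trace_sub]
  have nn : ∀ {A B : Matrix p p ℂ}, A.PosSemidef → B.PosSemidef → 0 ≤ (A * B).trace.re := by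
    intro A B hA hB
    have := trace_mul_nonneg_complex' hA hB
    rw [Complex.le_def] at this
    simpa using this.1
  have e1 := nn hDm hs
  have e2 := nn hDp ht
  rw [h1, h2]
  simp only [Matrix.add_mul, trace_add, Complex.add_re, Complex.sub_re]
  linarith

/-! #### Theorem 17, robust form: a configuration (i)–(v) keeps every cpsd matrix at a distance -/

/-- Remark 6.1, quantitatively: if `Y_{ab} = Tr(P_a P_b)` is entrywise `δ`-close to `X` and `Xv = 0`,
then `‖Σ_a v_a P_a‖₂² = vᵀ Y v = vᵀ(Y − X)v ≤ δ‖v‖₁²`. [cite: PrakashEtAl2017, Remark 6.1 (p20)] -/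
private theorem sum_norm_sq_combo_le {ι : Type*} [Fintype ι] {d : ℕ}
    {P : ι → Matrix (Fin d) (Fin d) ℂ} (hP : ∀ a, (P a).PosSemidef) {Y X : Matrix ι ι ℝ}
    (hYP : ∀ a b, ((Y a b : ℝ) : ℂ) = (P a * P b).trace) {δ : ℝ} (hcon : ∀ a b, |Y a b - X a b| ≤ δ)
    {v : ι → ℝ} (hv : X *ᵥ v = 0) :
    ∑ k, ∑ l, ‖(∑ a, ((v a : ℝ) : ℂ) • P a) k l‖ ^ 2 ≤ δ * (∑ a, |v a|) ^ 2 := by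
  obtain ⟨T, hT⟩ : ∃ T : Matrix (Fin d) (Fin d) ℂ, T = ∑ a, ((v a : ℝ) : ℂ) • P a := ⟨_, rfl⟩
  rw [← hT]
  have hTh : Tᴴ = T := by
    rw [hT, conjTranspose_sum]
    refine sum_congr rfl fun a _ => ?_
    rw [conjTranspose_smul, (hP a).1.eq, Complex.star_def, Complex.conj_ofReal]
  have htr : (Tᴴ * T).trace = (((v ⬝ᵥ (Y *ᵥ v) : ℝ)) : ℂ) := by
    rw [hTh, hT, Finset.sum_mul, trace_sum]
    have h1 : ∀ a, ((((v a : ℝ) : ℂ) • P a) * ∑ b, ((v b : ℝ) : ℂ) • P b).trace =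
        ∑ b, ((v a : ℝ) : ℂ) * (((v b : ℝ) : ℂ) * (P a * P b).trace) := by
      intro a
      rw [Matrix.mul_sum, trace_sum]
      refine sum_congr rfl fun b _ => ?_
      rw [Matrix.smul_mul, Matrix.mul_smul, trace_smul, trace_smul, smul_eq_mul, smul_eq_mul]
    simp only [h1, ← hYP]
    simp only [dotProduct, mulVec, Finset.mul_sum]
    push_cast
    exact sum_congr rfl fun a _ => sum_congr rfl fun b _ => by ring
  have hsum : ∑ k, ∑ l, ‖T k l‖ ^ 2 = v ⬝ᵥ (Y *ᵥ v) := by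
    have h := trace_conjTranspose_mul_self_eq_sum T
    rw [htr] at h
    exact_mod_cast h.symm
  rw [hsum]
  have h1 : v ⬝ᵥ (Y *ᵥ v) = v ⬝ᵥ ((Y - X) *ᵥ v) := by rw [sub_mulVec, hv, sub_zero]
  rw [h1]
  simp only [dotProduct, mulVec, Matrix.sub_apply]
  calc ∑ a, v a * ∑ b, (Y a b - X a b) * v b ≤ ∑ a, |v a| * ∑ b, δ * |v b| := by
        refine sum_le_sum fun a _ => ?_
        refine (le_abs_self _).trans ?_
        rw [abs_mul]
        refine mul_le_mul_of_nonneg_left ?_ (abs_nonneg _)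
        refine (abs_sum_le_sum_abs _ _).trans (sum_le_sum fun b _ => ?_)
        rw [abs_mul]
        exact mul_le_mul_of_nonneg_right (hcon a b) (abs_nonneg _)
    _ = δ * (∑ a, |v a|) ^ 2 := by
        rw [← Finset.sum_mul]
        simp_rw [← Finset.mul_sum]
        ring

/-- The algebraic core of the robust Theorem 17: with the constants spelled out, a cpsd `Y` that is
entrywise `δ`-close to `X` is contradictory. [cite: PrakashEtAl2017, Thm. 17 (p20), Remark 6.2 (p21)] -/
private theorem gap_core {ι : Type*} [Fintype ι] [DecidableEq ι] {X : Matrix ι ι ℝ}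
    (hXs : X.IsSymm) {i j : ι} {w w' : ι → ℝ} (hw : X *ᵥ w = 0) (hw' : X *ᵥ w' = 0)
    (hwi : w i ≠ 0) (hw'j : w' j ≠ 0) (hJ : ∀ a, a ≠ i → a ≠ j → w a = 0 ∨ X j a = 0)
    (hI : ∀ a, a ≠ i → a ≠ j → w' a = 0 ∨ X a i = 0) (hXij : X i j ≠ 0) (hii : 0 < X i i)
    (hjj : 0 < X j j) (hdet : X i j ^ 2 < X i i * X j j) {δ : ℝ} (hδ0 : 0 < δ) (hδ1 : δ ≤ 1)
    (hδg : Real.sqrt δ * ((Real.sqrt (X i i) + Real.sqrt (X j j)) ^ 2 +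
        X i i * X j j * (2 * Real.sqrt (1 + ∑ a, |X a a|) * (|w' j| * ∑ a, |w a| + |w i| * ∑ a, |w' a|)) /
          |X i j * w i * w' j|) ≤
      (Real.sqrt (X i i) * Real.sqrt (X j j)) * (Real.sqrt (X i i) * Real.sqrt (X j j) - X i j))
    {d : ℕ} {Y : Matrix ι ι ℝ} (hY : HasCpsdFactorization Y d) (hcon : ∀ a b, |Y a b - X a b| ≤ δ) :
    False := by
  classical
  obtain ⟨P, hP, hYP⟩ := hY
  -- names for the constants
  obtain ⟨ri, hri_def⟩ : ∃ r : ℝ, r = Real.sqrt (X i i) := ⟨_, rfl⟩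
  obtain ⟨rj, hrj_def⟩ : ∃ r : ℝ, r = Real.sqrt (X j j) := ⟨_, rfl⟩
  obtain ⟨L, hL_def⟩ : ∃ r : ℝ, r = ∑ a, |w a| := ⟨_, rfl⟩
  obtain ⟨L', hL'_def⟩ : ∃ r : ℝ, r = ∑ a, |w' a| := ⟨_, rfl⟩
  obtain ⟨B, hB_def⟩ : ∃ r : ℝ, r = 1 + ∑ a, |X a a| := ⟨_, rfl⟩
  obtain ⟨κ, hκ_def⟩ : ∃ r : ℝ, r = |X i j * w i * w' j| := ⟨_, rfl⟩
  obtain ⟨C, hC_def⟩ : ∃ r : ℝ, r = 2 * Real.sqrt B * (|w' j| * L + |w i| * L') := ⟨_, rfl⟩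
  rw [← hri_def, ← hrj_def, ← hL_def, ← hL'_def, ← hB_def, ← hκ_def, ← hC_def] at hδg
  have hri : ri * ri = X i i := by rw [hri_def]; exact Real.mul_self_sqrt hii.le
  have hrj : rj * rj = X j j := by rw [hrj_def]; exact Real.mul_self_sqrt hjj.le
  have hri0 : 0 < ri := by rw [hri_def]; exact Real.sqrt_pos.mpr hii
  have hrj0 : 0 < rj := by rw [hrj_def]; exact Real.sqrt_pos.mpr hjj
  have hL0 : 0 ≤ L := by rw [hL_def]; exact sum_nonneg fun a _ => abs_nonneg _
  have hL'0 : 0 ≤ L' := by rw [hL'_def]; exact sum_nonneg fun a _ => abs_nonneg _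
  have hB1 : 1 ≤ B := by
    have : 0 ≤ ∑ a, |X a a| := sum_nonneg fun a _ => abs_nonneg _
    linarith
  have hB0 : 0 ≤ B := by linarith
  have hκ0 : 0 < κ := by rw [hκ_def]; exact abs_pos.mpr (mul_ne_zero (mul_ne_zero hXij hwi) hw'j)
  have hC0 : 0 ≤ C := by rw [hC_def]; positivity
  have hij : i ≠ j := by
    rintro rfl
    rw [sq] at hdet
    exact lt_irrefl _ hdet
  have hgap : X i j < ri * rj := by
    rw [hri_def, hrj_def, ← Real.sqrt_mul hii.le]
    exact Real.lt_sqrt_of_sq_lt hdet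
  have hg0 : 0 < (ri * rj) * (ri * rj - X i j) := mul_pos (mul_pos hri0 hrj0) (sub_pos.mpr hgap)
  -- the exact relations carried by the kernel vectors: `X_jj w_j = −X_ij w_i`, `X_ii w'_i = −X_ij w'_j`
  have hrelj : X j j * w j = -(X i j * w i) := by
    have h := congrFun hw j
    simp only [mulVec, dotProduct, Pi.zero_apply] at h
    rw [← Finset.sum_subset (Finset.subset_univ ({i, j} : Finset ι)), Finset.sum_pair hij,
      hXs.apply i j] at h
    · linarith
    · intro a _ ha
      rw [Finset.mem_insert, Finset.mem_singleton, not_or] at ha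
      rcases hJ a ha.1 ha.2 with h0 | h0
      · rw [h0, mul_zero]
      · rw [h0, zero_mul]
  have hreli : X i i * w' i = -(X i j * w' j) := by
    have h := congrFun hw' i
    simp only [mulVec, dotProduct, Pi.zero_apply] at h
    rw [← Finset.sum_subset (Finset.subset_univ ({i, j} : Finset ι)), Finset.sum_pair hij] at h
    · linarith
    · intro a _ ha
      rw [Finset.mem_insert, Finset.mem_singleton, not_or] at ha
      rcases hI a ha.1 ha.2 with h0 | h0
      · rw [h0, mul_zero]
      · rw [hXs.apply a i, h0, zero_mul]
  -- facts about `Y`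
  have hYsymm : ∀ a b, Y a b = Y b a := fun a b => by
    have h := hYP a b
    rw [trace_mul_comm, ← hYP b a] at h
    exact_mod_cast h
  have hYre : ∀ a b, (P a * P b).trace.re = Y a b := fun a b => by
    rw [← hYP, Complex.ofReal_re]
  have hYdiag : ∀ a, Y a a = ∑ k, ∑ l, ‖P a k l‖ ^ 2 := fun a => by
    have h := hYP a a
    rw [trace_mul_self_eq_sum_of_isHermitian (hP a).1] at h
    exact_mod_cast h
  have hYnn : ∀ a b, 0 ≤ Y a b := fun a b => by
    have h := trace_mul_nonneg_complex' (hP a) (hP b)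
    rw [← hYP, Complex.zero_le_real] at h
    exact h
  have hcl : ∀ a b, Y a b ≤ X a b + δ ∧ X a b - δ ≤ Y a b := fun a b => by
    have h := hcon a b
    rw [abs_le] at h
    constructor <;> linarith [h.1, h.2]
  have hYB : ∀ a, Y a a ≤ B := fun a => by
    have h1 := (hcl a a).1
    have h2 : X a a ≤ |X a a| := le_abs_self _
    have h3 : |X a a| ≤ ∑ b, |X b b| :=
      Finset.single_le_sum (fun b _ => abs_nonneg (X b b)) (Finset.mem_univ a)
    linarith
  -- the two small Hermitian combinations (Remark 6.1)
  obtain ⟨S, hS_def⟩ : ∃ S : Matrix (Fin d) (Fin d) ℂ, S = ∑ a, ((w a : ℝ) : ℂ) • P a := ⟨_, rfl⟩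
  obtain ⟨S', hS'_def⟩ : ∃ S' : Matrix (Fin d) (Fin d) ℂ, S' = ∑ a, ((w' a : ℝ) : ℂ) • P a := ⟨_, rfl⟩
  have hS : ∑ k, ∑ l, ‖S k l‖ ^ 2 ≤ δ * L ^ 2 := by
    rw [hS_def, hL_def]; exact sum_norm_sq_combo_le hP hYP hcon hw
  have hS' : ∑ k, ∑ l, ‖S' k l‖ ^ 2 ≤ δ * L' ^ 2 := by
    rw [hS'_def, hL'_def]; exact sum_norm_sq_combo_le hP hYP hcon hw'
  -- Powers–Størmer for `s = √X_jj P_i`, `t = √X_ii P_j`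
  obtain ⟨s, hs_def⟩ : ∃ s : Matrix (Fin d) (Fin d) ℂ, s = ((rj : ℝ) : ℂ) • P i := ⟨_, rfl⟩
  obtain ⟨t, ht_def⟩ : ∃ t : Matrix (Fin d) (Fin d) ℂ, t = ((ri : ℝ) : ℂ) • P j := ⟨_, rfl⟩
  have hs_psd : s.PosSemidef := by rw [hs_def]; exact (hP i).smul (Complex.zero_le_real.mpr hrj0.le)
  have ht_psd : t.PosSemidef := by rw [ht_def]; exact (hP j).smul (Complex.zero_le_real.mpr hri0.le)
  obtain ⟨W, hW1, hW2, hPS⟩ := powers_stormer hs_psd ht_psd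
  -- LOWER side: `Tr((s−t)²) = X_jj Y_ii − 2√(X_iiX_jj) Y_ij + X_ii Y_jj ≥ g − δ L1`
  have hlowC : ((s - t) * (s - t)).trace =
      ((rj * rj * Y i i - 2 * (ri * rj) * Y i j + ri * ri * Y j j : ℝ) : ℂ) := by
    rw [hs_def, ht_def]
    simp only [Matrix.sub_mul, Matrix.mul_sub, Matrix.smul_mul, Matrix.mul_smul, trace_sub,
      trace_smul, smul_eq_mul, ← hYP, hYsymm j i]
    push_cast
    ring
  have hlow : 2 * (ri * rj) * (ri * rj - X i j) - δ * (ri + rj) ^ 2 ≤ ((s - t) * (s - t)).trace.re := by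
    rw [hlowC, Complex.ofReal_re]
    have h1 := (hcl i i).2
    have h2 := (hcl j j).2
    have h3 := (hcl i j).1
    have e : 2 * (ri * rj) * (ri * rj - X i j) - δ * (ri + rj) ^ 2 =
        rj * rj * (X i i - δ) - 2 * (ri * rj) * (X i j + δ) + ri * ri * (X j j - δ) := by
      rw [← hri, ← hrj]; ring
    rw [e]
    have p1 := mul_le_mul_of_nonneg_left h1 (mul_self_nonneg rj)
    have p2 := mul_le_mul_of_nonneg_left h2 (mul_self_nonneg ri)
    have p3 := mul_le_mul_of_nonneg_left h3 (by positivity : (0 : ℝ) ≤ 2 * (ri * rj))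
    linarith only [p1, p2, p3]
  -- UPPER side, step 1: the key identity `(X_ij w_i w'_j)(s² − t²) = (X_ii X_jj) M`
  obtain ⟨M, hM_def⟩ : ∃ M : Matrix (Fin d) (Fin d) ℂ,
    M = ((w' j * w j : ℝ) : ℂ) • (P j * P j) - ((w i * w' i : ℝ) : ℂ) • (P i * P i) := ⟨_, rfl⟩
  have hkey : ((X i j * w i * w' j : ℝ) : ℂ) • (s * s - t * t) = ((X i i * X j j : ℝ) : ℂ) • M := by
    have e1 : X i j * w i * w' j * (rj * rj) = -(X i i * X j j * (w i * w' i)) := by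
      rw [hrj]
      linear_combination (X j j * w i) * hreli
    have e2 : X i j * w i * w' j * (ri * ri) = -(X i i * X j j * (w' j * w j)) := by
      rw [hri]
      linear_combination (X i i * w' j) * hrelj
    have e1' : ((X i j * w i * w' j : ℝ) : ℂ) * (((rj : ℝ) : ℂ) * ((rj : ℝ) : ℂ)) =
        -(((X i i * X j j : ℝ) : ℂ) * ((w i * w' i : ℝ) : ℂ)) := by exact_mod_cast e1
    have e2' : ((X i j * w i * w' j : ℝ) : ℂ) * (((ri : ℝ) : ℂ) * ((ri : ℝ) : ℂ)) =
        -(((X i i * X j j : ℝ) : ℂ) * ((w' j * w j : ℝ) : ℂ)) := by exact_mod_cast e2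
    have hss : s * s = (((rj : ℝ) : ℂ) * ((rj : ℝ) : ℂ)) • (P i * P i) := by
      rw [hs_def, Matrix.smul_mul, Matrix.mul_smul, smul_smul]
    have htt : t * t = (((ri : ℝ) : ℂ) * ((ri : ℝ) : ℂ)) • (P j * P j) := by
      rw [ht_def, Matrix.smul_mul, Matrix.mul_smul, smul_smul]
    rw [hss, htt, hM_def, smul_sub, smul_smul, smul_smul, e1', e2', smul_sub, smul_smul, smul_smul,
      neg_smul, neg_smul, sub_neg_eq_add, neg_add_eq_sub]
  have hcoefR : X i j * w i * w' j ≠ 0 := mul_ne_zero (mul_ne_zero hXij hwi) hw'j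
  have hcoef : ((X i j * w i * w' j : ℝ) : ℂ) ≠ 0 := Complex.ofReal_ne_zero.mpr hcoefR
  have hN0 : s * s - t * t = ((X i i * X j j / (X i j * w i * w' j) : ℝ) : ℂ) • M := by
    calc s * s - t * t
        = ((((X i j * w i * w' j : ℝ) : ℂ))⁻¹ * ((X i j * w i * w' j : ℝ) : ℂ)) • (s * s - t * t) := by
          rw [inv_mul_cancel₀ hcoef, one_smul]
      _ = (((X i j * w i * w' j : ℝ) : ℂ))⁻¹ • (((X i i * X j j : ℝ) : ℂ) • M) := by
          rw [← smul_smul, hkey]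
      _ = ((X i i * X j j / (X i j * w i * w' j) : ℝ) : ℂ) • M := by
          rw [smul_smul, Complex.ofReal_div, div_eq_inv_mul]
  -- UPPER side, step 2: `M` = main terms − remainder, via `T_a := w'_j w_a P_jP_a − w_i w'_a P_aP_i`
  obtain ⟨T, hT_def⟩ : ∃ T : ι → Matrix (Fin d) (Fin d) ℂ, T = fun a =>
    ((w' j * w a : ℝ) : ℂ) • (P j * P a) - ((w i * w' a : ℝ) : ℂ) • (P a * P i) := ⟨_, rfl⟩
  have hTsum : ∑ a, T a = ((w' j : ℝ) : ℂ) • (P j * S) - ((w i : ℝ) : ℂ) • (S' * P i) := by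
    rw [hT_def, hS_def, hS'_def, Matrix.mul_sum, Finset.sum_mul, Finset.smul_sum, Finset.smul_sum,
      ← Finset.sum_sub_distrib]
    refine sum_congr rfl fun a _ => ?_
    dsimp only
    rw [Matrix.mul_smul, Matrix.smul_mul, smul_smul, smul_smul, Complex.ofReal_mul, Complex.ofReal_mul]
  have hTij : T i + T j = M := by
    rw [hT_def, hM_def]
    dsimp only
    rw [show ((w i * w' j : ℝ) : ℂ) = ((w' j * w i : ℝ) : ℂ) by rw [mul_comm]]
    abel
  obtain ⟨R, hR_def⟩ : ∃ R : Finset ι, R = (Finset.univ.erase i).erase j := ⟨_, rfl⟩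
  have hsplit : ∑ a, T a = T i + T j + ∑ a ∈ R, T a := by
    rw [hR_def, add_assoc,
      Finset.add_sum_erase _ _ (Finset.mem_erase.mpr ⟨hij.symm, Finset.mem_univ j⟩),
      Finset.add_sum_erase _ _ (Finset.mem_univ i)]
  have hMeq : M = ((w' j : ℝ) : ℂ) • (P j * S) - ((w i : ℝ) : ℂ) • (S' * P i) - ∑ a ∈ R, T a := by
    rw [← hTsum, hsplit, hTij]
    abel
  -- UPPER side, step 3: the estimate `|Tr(W M)| ≤ √δ C`
  have hsqB : ∀ a, Real.sqrt (∑ k, ∑ l, ‖P a k l‖ ^ 2) ≤ Real.sqrt B := fun a =>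
    Real.sqrt_le_sqrt (by rw [← hYdiag]; exact hYB a)
  have hmain1 : ‖(W * (P j * S)).trace‖ ≤ Real.sqrt B * (Real.sqrt δ * L) := by
    rw [← Matrix.mul_assoc]
    refine (norm_trace_mul_le _ _).trans ?_
    rw [sum_norm_sq_isometry_mul hW1]
    refine mul_le_mul (hsqB j) ?_ (Real.sqrt_nonneg _) ((Real.sqrt_nonneg _).trans (hsqB j))
    calc Real.sqrt (∑ k, ∑ l, ‖S k l‖ ^ 2) ≤ Real.sqrt (δ * L ^ 2) := Real.sqrt_le_sqrt hS
      _ = Real.sqrt δ * L := by rw [Real.sqrt_mul hδ0.le, Real.sqrt_sq hL0]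
  have hmain2 : ‖(W * (S' * P i)).trace‖ ≤ Real.sqrt B * (Real.sqrt δ * L') := by
    rw [← Matrix.mul_assoc, trace_mul_cycle]
    refine (norm_trace_mul_le _ _).trans ?_
    rw [sum_norm_sq_mul_coisometry hW2]
    refine mul_le_mul (hsqB i) ?_ (Real.sqrt_nonneg _) ((Real.sqrt_nonneg _).trans (hsqB i))
    calc Real.sqrt (∑ k, ∑ l, ‖S' k l‖ ^ 2) ≤ Real.sqrt (δ * L' ^ 2) := Real.sqrt_le_sqrt hS'
      _ = Real.sqrt δ * L' := by rw [Real.sqrt_mul hδ0.le, Real.sqrt_sq hL'0]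
  -- orthogonal pairs: `X_ab = 0 ⇒ |Tr(W P_a P_b)| ≤ √B √δ`
  have horth : ∀ a b, X a b = 0 → ‖(W * (P a * P b)).trace‖ ≤ Real.sqrt B * Real.sqrt δ := by
    intro a b hab
    have h := norm_trace_unitary_mul_mul_sq_le (hP a) (hP b) hW2
    rw [hYre, hYre, hYre] at h
    have hab' : Y a b ≤ δ := by have := (hcl a b).1; rw [hab] at this; linarith
    have h2 : ‖(W * (P a * P b)).trace‖ ^ 2 ≤ B * δ := by
      refine h.trans ?_
      refine mul_le_mul ?_ hab' (hYnn a b) hB0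
      calc Real.sqrt (Y a a * Y b b) ≤ Real.sqrt (B * B) :=
            Real.sqrt_le_sqrt (mul_le_mul (hYB a) (hYB b) (hYnn b b) hB0)
        _ = B := Real.sqrt_mul_self hB0
    calc ‖(W * (P a * P b)).trace‖ = Real.sqrt (‖(W * (P a * P b)).trace‖ ^ 2) :=
          (Real.sqrt_sq (norm_nonneg _)).symm
      _ ≤ Real.sqrt (B * δ) := Real.sqrt_le_sqrt h2
      _ = Real.sqrt B * Real.sqrt δ := Real.sqrt_mul hB0 δ
  have hrest : ∀ a ∈ R, ‖(W * T a).trace‖ ≤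
      (|w' j| * |w a| + |w i| * |w' a|) * (Real.sqrt B * Real.sqrt δ) := by
    intro a ha
    rw [hR_def, Finset.mem_erase, Finset.mem_erase] at ha
    have hai : a ≠ i := ha.2.1
    have haj : a ≠ j := ha.1
    have hT1 : ‖(W * (((w' j * w a : ℝ) : ℂ) • (P j * P a))).trace‖ ≤
        |w' j| * |w a| * (Real.sqrt B * Real.sqrt δ) := by
      rw [Matrix.mul_smul, trace_smul, smul_eq_mul, norm_mul, Complex.norm_real, Real.norm_eq_abs,
        abs_mul]
      rcases hJ a hai haj with h0 | h0
      · rw [h0, abs_zero, mul_zero, zero_mul, zero_mul]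
      · exact mul_le_mul_of_nonneg_left (horth j a h0) (by positivity)
    have hT2 : ‖(W * (((w i * w' a : ℝ) : ℂ) • (P a * P i))).trace‖ ≤
        |w i| * |w' a| * (Real.sqrt B * Real.sqrt δ) := by
      rw [Matrix.mul_smul, trace_smul, smul_eq_mul, norm_mul, Complex.norm_real, Real.norm_eq_abs,
        abs_mul]
      rcases hI a hai haj with h0 | h0
      · rw [h0, abs_zero, mul_zero, zero_mul, zero_mul]
      · exact mul_le_mul_of_nonneg_left (horth a i h0) (by positivity)
    rw [hT_def]
    dsimp only
    rw [Matrix.mul_sub, trace_sub]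
    refine (norm_sub_le _ _).trans ?_
    rw [add_mul]
    exact add_le_add hT1 hT2
  have hWM : ‖(W * M).trace‖ ≤ Real.sqrt δ * C := by
    rw [hMeq, Matrix.mul_sub, Matrix.mul_sub, trace_sub, trace_sub, Matrix.mul_smul, Matrix.mul_smul,
      trace_smul, trace_smul, Matrix.mul_sum, trace_sum]
    refine (norm_sub_le _ _).trans ?_
    refine (add_le_add (norm_sub_le _ _) (norm_sum_le _ _)).trans ?_
    rw [smul_eq_mul, smul_eq_mul, norm_mul, norm_mul, Complex.norm_real, Complex.norm_real,
      Real.norm_eq_abs, Real.norm_eq_abs]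
    have hsumR : ∑ a ∈ R, ‖(W * T a).trace‖ ≤
        (|w' j| * L + |w i| * L') * (Real.sqrt B * Real.sqrt δ) := by
      refine (Finset.sum_le_sum hrest).trans ?_
      rw [← Finset.sum_mul]
      refine mul_le_mul_of_nonneg_right ?_ (by positivity)
      have hsub : ∑ a ∈ R, (|w' j| * |w a| + |w i| * |w' a|) ≤
          ∑ a, (|w' j| * |w a| + |w i| * |w' a|) :=
        Finset.sum_le_sum_of_subset_of_nonneg (Finset.subset_univ R) fun a _ _ => by positivity
      refine hsub.trans (le_of_eq ?_)
      rw [Finset.sum_add_distrib, ← Finset.mul_sum, ← Finset.mul_sum, hL_def, hL'_def]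
    calc |w' j| * ‖(W * (P j * S)).trace‖ + |w i| * ‖(W * (S' * P i)).trace‖ +
          ∑ a ∈ R, ‖(W * T a).trace‖
        ≤ |w' j| * (Real.sqrt B * (Real.sqrt δ * L)) + |w i| * (Real.sqrt B * (Real.sqrt δ * L')) +
          (|w' j| * L + |w i| * L') * (Real.sqrt B * Real.sqrt δ) :=
          add_le_add (add_le_add (mul_le_mul_of_nonneg_left hmain1 (abs_nonneg _))
            (mul_le_mul_of_nonneg_left hmain2 (abs_nonneg _))) hsumR
      _ = Real.sqrt δ * C := by rw [hC_def]; ring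
  -- UPPER side, step 4: `Re Tr(W(s² − t²)) ≤ √δ · X_ii X_jj C / κ`
  have hup : (W * (s * s - t * t)).trace.re ≤ Real.sqrt δ * (X i i * X j j * C / κ) := by
    refine (Complex.re_le_norm _).trans ?_
    rw [hN0, Matrix.mul_smul, trace_smul, smul_eq_mul, norm_mul, Complex.norm_real, Real.norm_eq_abs,
      abs_div, abs_of_pos (mul_pos hii hjj), ← hκ_def]
    calc X i i * X j j / κ * ‖(W * M).trace‖ ≤ X i i * X j j / κ * (Real.sqrt δ * C) :=
          mul_le_mul_of_nonneg_left hWM (by positivity)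
      _ = Real.sqrt δ * (X i i * X j j * C / κ) := by ring
  -- conclusion
  have hfin := hlow.trans (hPS.trans hup)
  have hδsq : δ ≤ Real.sqrt δ := by
    have h1 : Real.sqrt δ ≤ 1 := Real.sqrt_le_one.mpr hδ1
    calc δ = Real.sqrt δ * Real.sqrt δ := (Real.mul_self_sqrt hδ0.le).symm
      _ ≤ Real.sqrt δ * 1 := mul_le_mul_of_nonneg_left h1 (Real.sqrt_nonneg _)
      _ = Real.sqrt δ := mul_one _
  have hL10 : 0 ≤ (ri + rj) ^ 2 := sq_nonneg _
  have h1 : δ * (ri + rj) ^ 2 ≤ Real.sqrt δ * (ri + rj) ^ 2 := mul_le_mul_of_nonneg_right hδsq hL10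
  linarith only [hfin, h1, hδg, hg0]

/-- **PSVW Theorem 17 / Remark 6.2, quantitative finite-dimensional form.** In the Gram-free
formulation of `HasCpsdFactorization.exists_row_eq_mul_row` (kernel vectors `w, w'` of a symmetric
`X` isolating the indices `i, j`, `X_{ij} ≠ 0`), if moreover `X_{ii}, X_{jj} > 0` and
`X_{ij}² < X_{ii}X_{jj}` (rows `i, j` NOT parallel — (iv) of Theorem 17), then `X` is bounded away
from ALL cpsd matrices of ALL sizes: there is `δ > 0` such that no `Y` with a `CS_+`-factorization
(of any size `d`) is entrywise `δ`-close to `X`. This replaces the appeal to Gram factorizations by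
positive elements of a tracial von Neumann algebra `(𝒩, τ)` ([BLP]: every point of `cl(CS_+)` has
one) in the printed route to "`X ∉ cl(CS_+ⁿ)`" (Remark 6.2): the printed algebra is run
approximately inside `M_d(ℂ)` — `‖Σ_a w_a P_a‖₂² = wᵀYw ≤ δ‖w‖₁²` (Remark 6.1),
`|Tr(W P_j P_a)|² ≤ ‖P_j‖₂‖P_a‖₂·Tr(P_jP_a)` (for "`Tr(pq) = 0 ⇒ pq = 0`"), whence
`|Tr(W(X_{jj}P_i² − X_{ii}P_j²))| = O(√δ)` for every unitary `W`, and the uniqueness of positive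
square roots is replaced by the Powers–Størmer inequality
`‖√X_{jj}P_i − √X_{ii}P_j‖₂² ≤ Re Tr(W(X_{jj}P_i² − X_{ii}P_j²))` for the sign `W` of the difference;
the left side is `≥ 2√(X_{ii}X_{jj})(√(X_{ii}X_{jj}) − X_{ij}) − O(δ) > 0`.
[cite: PrakashEtAl2017, Thm. 17 (p20), Remark 6.2 (p21)] -/
theorem exists_gap_of_kernel_config {ι : Type*} [Fintype ι] [DecidableEq ι] {X : Matrix ι ι ℝ}
    (hXs : X.IsSymm) {i j : ι} {w w' : ι → ℝ} (hw : X *ᵥ w = 0) (hw' : X *ᵥ w' = 0)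
    (hwi : w i ≠ 0) (hw'j : w' j ≠ 0) (hJ : ∀ a, a ≠ i → a ≠ j → w a = 0 ∨ X j a = 0)
    (hI : ∀ a, a ≠ i → a ≠ j → w' a = 0 ∨ X a i = 0) (hXij : X i j ≠ 0) (hii : 0 < X i i)
    (hjj : 0 < X j j) (hdet : X i j ^ 2 < X i i * X j j) :
    ∃ δ : ℝ, 0 < δ ∧ ∀ (d : ℕ) (Y : Matrix ι ι ℝ), HasCpsdFactorization Y d →
      ∃ a b, δ < |Y a b - X a b| := by
  classical
  -- the gap `g/2 = √(X_iiX_jj)(√(X_iiX_jj) − X_ij) > 0`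
  have hgap : X i j < Real.sqrt (X i i) * Real.sqrt (X j j) := by
    rw [← Real.sqrt_mul hii.le]
    exact Real.lt_sqrt_of_sq_lt hdet
  have hg0 : 0 < (Real.sqrt (X i i) * Real.sqrt (X j j)) * (Real.sqrt (X i i) * Real.sqrt (X j j) - X i j) :=
    mul_pos (mul_pos (Real.sqrt_pos.mpr hii) (Real.sqrt_pos.mpr hjj)) (sub_pos.mpr hgap)
  obtain ⟨K, hK_def⟩ : ∃ K : ℝ, K = (Real.sqrt (X i i) + Real.sqrt (X j j)) ^ 2 +
      X i i * X j j * (2 * Real.sqrt (1 + ∑ a, |X a a|) * (|w' j| * ∑ a, |w a| + |w i| * ∑ a, |w' a|)) /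
        |X i j * w i * w' j| := ⟨_, rfl⟩
  have hK0 : 0 < K := by
    rw [hK_def]
    have h1 : 0 < (Real.sqrt (X i i) + Real.sqrt (X j j)) ^ 2 := by
      have := Real.sqrt_pos.mpr hii
      positivity
    have h2 : 0 ≤ X i i * X j j * (2 * Real.sqrt (1 + ∑ a, |X a a|) *
        (|w' j| * ∑ a, |w a| + |w i| * ∑ a, |w' a|)) / |X i j * w i * w' j| := by positivity
    linarith
  obtain ⟨g, hg_def⟩ : ∃ g : ℝ,
      g = (Real.sqrt (X i i) * Real.sqrt (X j j)) * (Real.sqrt (X i i) * Real.sqrt (X j j) - X i j) :=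
    ⟨_, rfl⟩
  rw [← hg_def] at hg0
  set δ : ℝ := min 1 ((g / K) ^ 2) with hδ_def
  have hδ0 : 0 < δ := lt_min one_pos (pow_pos (div_pos hg0 hK0) 2)
  have hδ1 : δ ≤ 1 := min_le_left _ _
  have hsqδ : Real.sqrt δ ≤ g / K := Real.sqrt_le_iff.mpr ⟨by positivity, min_le_right _ _⟩
  have hδg : Real.sqrt δ * K ≤ g := by
    have := mul_le_mul_of_nonneg_right hsqδ hK0.le
    rwa [div_mul_cancel₀ _ hK0.ne'] at this
  refine ⟨δ, hδ0, fun d Y hY => ?_⟩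
  by_contra hcon
  push Not at hcon
  rw [hK_def, hg_def] at hδg
  exact gap_core hXs hw hw' hwi hw'j hJ hI hXij hii hjj hdet hδ0 hδ1 hδg hY hcon

end RobustThm17

/-! #### The cycle `C_n`, `n = m + 2 ≥ 3`: adjacency and the kernel vectors of `A − 2cos θ·I` (as in the companion file) -/

section CycleKernel
open Real
open Fin.CommRing
variable {m : ℕ}

/-- Adjacency in the cycle graph `C_{m+2}`: `a ∼ b` iff `a = b ± 1`. [folklore] -/
private theorem cycleGraph_adj_iff (a b : Fin (m + 2)) :
    (SimpleGraph.cycleGraph (m + 2)).Adj a b ↔ a = b + 1 ∨ b = a + 1 := by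
  rw [SimpleGraph.cycleGraph_adj, sub_eq_iff_eq_add, sub_eq_iff_eq_add, add_comm (1 : Fin (m + 2)) b,
    add_comm (1 : Fin (m + 2)) a]


/-- `(A(C_n) w)_v = w_{v−1} + w_{v+1}` for `n ≥ 3`. [folklore] -/
private theorem cycle_adjMatrix_mulVec (hm : 1 ≤ m) (w : Fin (m + 2) → ℝ) (v : Fin (m + 2)) :
    ((SimpleGraph.cycleGraph (m + 2)).adjMatrix ℝ *ᵥ w) v = w (v - 1) + w (v + 1) := by
  rw [SimpleGraph.adjMatrix_mulVec_apply, SimpleGraph.cycleGraph_neighborFinset, Finset.sum_pair]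
  intro h
  have h2 : (1 : Fin (m + 2)) + 1 = 0 := by linear_combination (-1 : Fin (m + 2)) * h
  have h3 := congrArg Fin.val h2
  rw [Fin.val_add, Fin.val_one, Fin.val_zero, Nat.mod_eq_of_lt (by omega)] at h3
  omega

/-- For `θ` with `θ·n ∈ 2πℤ`, the vector `k ↦ sin(θk + φ)` is an eigenvector of `A(C_n)` for `2cos θ`,
i.e. lies in the kernel of `A(C_n) − 2cos θ·I` ("`λ_t … with multiplicity 2`", p21). [cite: PrakashEtAl2017, Lemma 11 proof (p21)] -/
private theorem cycle_sub_mulVec_sin (hm : 1 ≤ m) (θ φ : ℝ) (t : ℕ) (hθ : θ * (m + 2 : ℕ) = 2 * π * t) :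
    ((SimpleGraph.cycleGraph (m + 2)).adjMatrix ℝ -
        (2 * Real.cos θ) • (1 : Matrix (Fin (m + 2)) (Fin (m + 2)) ℝ)) *ᵥ
      (fun k : Fin (m + 2) => Real.sin (θ * k + φ)) = 0 := by
  -- the periodic extension `g(x) = sin(θx + φ)`, `g(x + n) = g(x)`
  set g : ℝ → ℝ := fun x => Real.sin (θ * x + φ) with hg
  have hper : ∀ x, g (x + (m + 2 : ℕ)) = g x := by
    intro x
    simp only [hg]
    rw [mul_add, hθ, show θ * x + 2 * π * t + φ = θ * x + φ + t * (2 * π) by ring,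
      Real.sin_add_nat_mul_two_pi]
  have hsucc : ∀ v : Fin (m + 2), g ((v + 1 : Fin (m + 2)) : ℕ) = g ((v : ℕ) + 1) := by
    intro v
    rw [Fin.val_add_one]
    split_ifs with hv
    · rw [hv, Fin.val_last, ← hper ((0 : ℕ) : ℝ)]
      congr 1
      push_cast
      ring
    · push_cast
      rfl
  have hpred : ∀ v : Fin (m + 2), g ((v - 1 : Fin (m + 2)) : ℕ) = g ((v : ℕ) - 1) := by
    intro v
    rw [Fin.coe_sub_one]
    split_ifs with hv
    · rw [hv, Fin.val_zero, ← hper (((0 : ℕ) : ℝ) - 1)]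
      congr 1
      push_cast
      ring
    · have h1 : 1 ≤ (v : ℕ) := by
        rcases Nat.eq_zero_or_pos (v : ℕ) with h | h
        · exact absurd (Fin.ext h) hv
        · exact h
      rw [Nat.cast_sub h1, Nat.cast_one]
  ext v
  rw [sub_mulVec, Pi.sub_apply, cycle_adjMatrix_mulVec hm, smul_mulVec, one_mulVec, Pi.zero_apply,
    Pi.smul_apply, smul_eq_mul]
  have e1 : Real.sin (θ * ((v - 1 : Fin (m + 2)) : ℕ) + φ) = g ((v : ℕ) - 1) := hpred v
  have e2 : Real.sin (θ * ((v + 1 : Fin (m + 2)) : ℕ) + φ) = g ((v : ℕ) + 1) := hsucc v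
  rw [e1, e2]
  simp only [hg]
  have key : ∀ U : ℝ, Real.sin (U - θ) + Real.sin (U + θ) - 2 * Real.cos θ * Real.sin U = 0 := by
    intro U
    rw [Real.sin_sub, Real.sin_add]
    ring
  have e3 : θ * ((v : ℕ) - 1 : ℝ) + φ = (θ * ((v : ℕ) : ℝ) + φ) - θ := by ring
  have e4 : θ * ((v : ℕ) + 1 : ℝ) + φ = (θ * ((v : ℕ) : ℝ) + φ) + θ := by ring
  rw [e3, e4]
  linarith [key (θ * ((v : ℕ) : ℝ) + φ)]

end CycleKernel


/-! #### Remark 6.2 without [BLP]: `A_t − λ_t I` is bounded away from `CS_+` -/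

section Rem62

open Real
open Fin.CommRing

variable {m : ℕ}

/-- **PSVW Lemma 11 + Remark 6.2, quantitative form on `Fin (m+2)`, `m + 2 = 2t + 1`, `t ≥ 2`**: the
matrix `X = A(C_{2t+1}) − λ_t I` satisfies the hypotheses of the robust Theorem 17
(`exists_gap_of_kernel_config`) with `i* = 0`, `j* = 1` and the kernel vectors `sin(θ(k−2))`,
`sin(θ(k+1))`, `θ = 2πt/(2t+1)` of the exact proof (`lemma11_core`), and `det X[{0,1}] = λ_t² − 1 > 0`;
hence some `δ > 0` separates `X` entrywise from every cpsd matrix of every size.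
[cite: PrakashEtAl2017, Lemma 11 (p20–p21), Remark 6.2 (p21)] -/
private theorem cycle_sub_gap (m t : ℕ) (ht : 2 ≤ t) (hm : m + 2 = 2 * t + 1) :
    ∃ δ : ℝ, 0 < δ ∧ ∀ (d : ℕ) (Y : Matrix (Fin (m + 2)) (Fin (m + 2)) ℝ), HasCpsdFactorization Y d →
      ∃ a b, δ < |Y a b - ((SimpleGraph.cycleGraph (m + 2)).adjMatrix ℝ -
        (2 * Real.cos (2 * Real.pi * t / (2 * t + 1))) • (1 : Matrix (Fin (m + 2)) (Fin (m + 2)) ℝ)) a b| := by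
  classical
  have hm1 : 1 ≤ m := by omega
  have hnR : ((m + 2 : ℕ) : ℝ) = 2 * t + 1 := by exact_mod_cast hm
  set θ : ℝ := 2 * Real.pi * t / (2 * t + 1) with hθ
  have hnpos : (0 : ℝ) < 2 * t + 1 := by positivity
  have hθn : θ * (m + 2 : ℕ) = 2 * π * t := by rw [hnR, hθ, div_mul_cancel₀ _ hnpos.ne']
  have hθeq : θ = π - π / (2 * t + 1) := by rw [hθ]; field_simp; ring
  have ht2 : (2 : ℝ) ≤ t := by exact_mod_cast ht
  have hθlt : θ < π := by
    rw [hθeq]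
    have : 0 < π / (2 * t + 1) := div_pos Real.pi_pos hnpos
    linarith
  have hθgt : 2 * π / 3 < θ := by
    rw [hθeq, show 2 * π / 3 = π - π / 3 by ring]
    have : π / (2 * t + 1) < π / 3 := div_lt_div_of_pos_left Real.pi_pos (by norm_num) (by linarith)
    linarith
  have hθpos : 0 < θ := by linarith [Real.pi_pos]
  set lam : ℝ := 2 * Real.cos θ with hlam
  have hlam_lt : lam < -1 := by
    have : Real.cos θ < Real.cos (2 * π / 3) :=
      Real.cos_lt_cos_of_nonneg_of_le_pi (by positivity) hθlt.le hθgt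
    rw [show 2 * π / 3 = π - π / 3 by ring, Real.cos_pi_sub, Real.cos_pi_div_three] at this
    rw [hlam]
    linarith
  have hsin2θ : Real.sin (2 * θ) ≠ 0 := by
    have h1 : Real.sin (2 * θ) = -Real.sin (2 * π / (2 * t + 1)) := by
      rw [hθeq, show 2 * (π - π / (2 * t + 1)) = -(2 * π / (2 * t + 1)) + (1 : ℕ) * (2 * π) by push_cast; ring,
        Real.sin_add_nat_mul_two_pi, Real.sin_neg]
    have h2 : 0 < Real.sin (2 * π / (2 * t + 1)) := by
      apply Real.sin_pos_of_pos_of_lt_pi (by positivity)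
      rw [div_lt_iff₀ hnpos]
      nlinarith [Real.pi_pos]
    rw [h1]
    linarith
  set X : Matrix (Fin (m + 2)) (Fin (m + 2)) ℝ := (SimpleGraph.cycleGraph (m + 2)).adjMatrix ℝ -
    lam • (1 : Matrix (Fin (m + 2)) (Fin (m + 2)) ℝ) with hXdef
  have hXapply : ∀ a b : Fin (m + 2), X a b =
      (if (SimpleGraph.cycleGraph (m + 2)).Adj a b then 1 else 0) - lam * (if a = b then 1 else 0) := by
    intro a b
    rw [hXdef, Matrix.sub_apply, Matrix.smul_apply, Matrix.one_apply, SimpleGraph.adjMatrix_apply,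
      smul_eq_mul]
  have hXdiag : ∀ a : Fin (m + 2), X a a = -lam := by
    intro a
    rw [hXapply, if_neg (SimpleGraph.irrefl _), if_pos rfl]
    ring
  have hXoff : ∀ a b : Fin (m + 2), a ≠ b → ¬ (SimpleGraph.cycleGraph (m + 2)).Adj a b → X a b = 0 := by
    intro a b hab hadj
    rw [hXapply, if_neg hadj, if_neg hab]
    ring
  have h01 : (SimpleGraph.cycleGraph (m + 2)).Adj 0 1 := by
    rw [cycleGraph_adj_iff]
    exact Or.inr (by ring)
  have h10ne : (1 : Fin (m + 2)) ≠ 0 := by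
    intro h
    have := congrArg Fin.val h
    rw [Fin.val_one, Fin.val_zero] at this
    omega
  have hX01 : X 0 1 = 1 := by
    rw [hXapply, if_pos h01, if_neg h10ne.symm]
    ring
  have hXs : X.IsSymm :=
    (SimpleGraph.isSymm_adjMatrix _).sub ((isSymm_one).smul _)
  -- kernel vectors
  have hw : X *ᵥ (fun k : Fin (m + 2) => Real.sin (θ * k + -(2 * θ))) = 0 :=
    cycle_sub_mulVec_sin hm1 θ (-(2 * θ)) t hθn
  have hw' : X *ᵥ (fun k : Fin (m + 2) => Real.sin (θ * k + θ)) = 0 :=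
    cycle_sub_mulVec_sin hm1 θ θ t hθn
  have h2val : ((1 + 1 : Fin (m + 2)) : ℕ) = 2 := by
    rw [Fin.val_add, Fin.val_one, Nat.mod_eq_of_lt (by omega)]
  have hgap := exists_gap_of_kernel_config hXs (i := 0) (j := 1) hw hw'
    (by -- `w_0 = sin(−2θ) ≠ 0`
      simp only [Fin.val_zero, Nat.cast_zero, mul_zero, zero_add, Real.sin_neg, neg_ne_zero]
      exact hsin2θ)
    (by -- `w'_1 = sin(2θ) ≠ 0`
      simp only [Fin.val_one, Nat.cast_one, mul_one, show θ + θ = 2 * θ by ring]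
      exact hsin2θ)
    (by -- other indices: `a = 2` has `w_2 = 0`, else `1 ≁ a`
      intro a ha0 ha1
      by_cases ha2 : a = 1 + 1
      · left
        show Real.sin (θ * ((a : ℕ) : ℝ) + -(2 * θ)) = 0
        rw [ha2, h2val, show θ * ((2 : ℕ) : ℝ) + -(2 * θ) = 0 by push_cast; ring, Real.sin_zero]
      · right
        refine hXoff 1 a (Ne.symm ha1) fun hadj => ?_
        rw [cycleGraph_adj_iff] at hadj
        rcases hadj with h | h
        · exact ha0 (by linear_combination (-1 : Fin (m + 2)) * h)
        · exact ha2 h)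
    (by -- other indices: `a = −1` has `w'_a = sin(θn) = 0`, else `a ≁ 0`
      intro a ha0 ha1
      by_cases ha2 : a = -1
      · left
        show Real.sin (θ * ((a : ℕ) : ℝ) + θ) = 0
        rw [ha2, Fin.coe_neg_one, show θ * ((m + 1 : ℕ) : ℝ) + θ = θ * ((m + 2 : ℕ) : ℝ) by push_cast; ring,
          hθn, show 2 * π * (t : ℝ) = ((2 * t : ℕ) : ℝ) * π by push_cast; ring, Real.sin_nat_mul_pi]
      · right
        refine hXoff a 0 ha0 fun hadj => ?_
        rw [cycleGraph_adj_iff] at hadj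
        rcases hadj with h | h
        · exact ha1 (by rw [h, zero_add])
        · exact ha2 (by linear_combination (-1 : Fin (m + 2)) * h))
    (by rw [hX01]; exact one_ne_zero)
    (by rw [hXdiag]; linarith)
    (by rw [hXdiag]; linarith)
    (by rw [hX01, hXdiag, hXdiag]; nlinarith)
  rw [hXdef, hlam, hθ] at hgap
  exact hgap

/-- **PSVW Remark 6.2** (p21): "the matrices `A_t − λ_t I` constructed in Lemma 11 are doubly-nonnegative
and do not belong to the closure of `CS_+`" — here PROVED without the von-Neumann-algebraic
characterisation of `cl(CS_+)` of [BLP] that the printed remark invokes: by `cycle_sub_gap` some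
entrywise `δ`-box around `A_t − λ_t I` contains no cpsd matrix of any size, and such a box is open in
`Matrix (Fin (2t+1)) (Fin (2t+1)) ℝ`. (Doubly-nonnegativity is `PrakashEtAl2017_lemma11_holds`.)
[cite: PrakashEtAl2017, Remark 6.2 (p21), Lemma 11 (p20–p21)] -/
theorem PrakashEtAl2017_rem62 (t : ℕ) (ht : 2 ≤ t) :
    ((SimpleGraph.cycleGraph (2 * t + 1)).adjMatrix ℝ -
        (2 * Real.cos (2 * Real.pi * t / (2 * t + 1))) • (1 : Matrix (Fin (2 * t + 1)) (Fin (2 * t + 1)) ℝ)) ∉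
      closure {X : Matrix (Fin (2 * t + 1)) (Fin (2 * t + 1)) ℝ | IsCpsd X} := by
  obtain ⟨m, hm⟩ : ∃ m, 2 * t + 1 = m + 2 := ⟨2 * t - 1, by omega⟩
  rw [hm]
  set X := (SimpleGraph.cycleGraph (m + 2)).adjMatrix ℝ -
    (2 * Real.cos (2 * Real.pi * t / (2 * t + 1))) • (1 : Matrix (Fin (m + 2)) (Fin (m + 2)) ℝ) with hX
  obtain ⟨δ, hδ, hgap⟩ := cycle_sub_gap m t ht hm.symm
  rw [← hX] at hgap
  intro hcl
  -- the open entrywise `δ`-box around `X`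
  set U : Set (Matrix (Fin (m + 2)) (Fin (m + 2)) ℝ) :=
    ⋂ a, ⋂ b, (fun Y : Matrix (Fin (m + 2)) (Fin (m + 2)) ℝ => |Y a b - X a b|) ⁻¹' Set.Iio δ with hU
  have hUopen : IsOpen U := by
    refine isOpen_iInter_of_finite fun a => isOpen_iInter_of_finite fun b => ?_
    refine isOpen_Iio.preimage ?_
    exact ((continuous_id.matrix_elem a b).sub continuous_const).abs
  have hXU : X ∈ U := by
    simp only [hU, Set.mem_iInter, Set.mem_preimage, Set.mem_Iio, sub_self, abs_zero]
    exact fun _ _ => hδ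
  obtain ⟨Y, hYU, hYcpsd⟩ := mem_closure_iff.mp hcl U hUopen hXU
  obtain ⟨d, hYd⟩ := hYcpsd
  obtain ⟨a, b, hab⟩ := hgap d Y hYd
  simp only [hU, Set.mem_iInter, Set.mem_preimage, Set.mem_Iio] at hYU
  exact lt_asymm hab (hYU a b)

end Rem62

/-! ### Theorem 18, direction "⇒": a graph with a `C_{2t+1}`-subgraph (`t ≥ 2`) is not cpsd -/

section Thm18mp

open Real

/-- `xᵀ A_G x ≥ −|V| ‖x‖²` for the adjacency matrix of a graph (entries in `{0,1}`, Cauchy–Schwarz).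
[folklore] -/
private theorem adjMatrix_quadratic_lower {ι : Type} [Fintype ι] [DecidableEq ι] (G : SimpleGraph ι)
    [DecidableRel G.Adj] (x : ι → ℝ) :
    -((Fintype.card ι : ℝ) * ∑ u, x u ^ 2) ≤ x ⬝ᵥ (G.adjMatrix ℝ *ᵥ x) := by
  have h1 : x ⬝ᵥ (G.adjMatrix ℝ *ᵥ x) ≥ -∑ u, ∑ v, |x u| * |x v| := by
    simp only [dotProduct, mulVec, Finset.mul_sum, ge_iff_le, ← Finset.sum_neg_distrib]
    refine sum_le_sum fun u _ => sum_le_sum fun v _ => ?_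
    rw [SimpleGraph.adjMatrix_apply]
    split_ifs
    · rw [one_mul, ← abs_mul]; exact neg_abs_le _
    · rw [zero_mul, mul_zero]; exact neg_nonpos.mpr (mul_nonneg (abs_nonneg _) (abs_nonneg _))
  have h2 : ∑ u, ∑ v, |x u| * |x v| = (∑ u, |x u|) ^ 2 := by
    rw [sq, Finset.sum_mul_sum]
  have h3 : (∑ u, |x u| * 1) ^ 2 ≤ (∑ u, |x u| ^ 2) * ∑ u : ι, (1 : ℝ) ^ 2 :=
    Finset.sum_mul_sq_le_sq_mul_sq _ _ _
  simp only [one_pow, Finset.sum_const, Finset.card_univ, nsmul_eq_mul, mul_one, sq_abs] at h3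
  rw [ge_iff_le, h2] at h1
  nlinarith [h1, h3]

/-- **Theorem 18 (⇒), core construction on `Fin (m+2)`, `m + 2 = 2t + 1`, `t ≥ 2`.** If the cycle
`C_{2t+1}` maps injectively into `G` along edges, then the printed matrix
`X_a = X̃ + aI + bA_G` (`X̃` = `A_t − λ_t I` placed on the image of the cycle, `0 < b ≤ a/|V|`,
`a + b ≤ δ` with `δ` from `cycle_sub_gap`) is doubly nonnegative with support EXACTLY `G` and is not
cpsd: a `CS_+`-factorization of `X_a` restricts to one of its principal submatrix on the cycle, which is
entrywise `(a+b)`-close to `A_t − λ_t I`. [cite: PrakashEtAl2017, Thm. 18 proof (p21)] -/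
private theorem thm18_core (m t : ℕ) (ht : 2 ≤ t) (hm : m + 2 = 2 * t + 1) {ι : Type} [Fintype ι]
    [DecidableEq ι] (G : SimpleGraph ι) (f : Fin (m + 2) → ι) (hf : Function.Injective f)
    (hadj : ∀ a, G.Adj (f a) (f (a + 1))) :
    ∃ X : Matrix ι ι ℝ, IsDnn X ∧ (∀ u v, u ≠ v → (X u v ≠ 0 ↔ G.Adj u v)) ∧ ¬ IsCpsd X := by
  classical
  -- `X0 = A_t − λ_t I` is doubly nonnegative (Lemma 11, `PrakashEtAl2017_lemma11_holds`, transported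
  -- from `Fin (2t+1)` to `Fin (m+2)`)
  have hX0dnn : IsDnn ((SimpleGraph.cycleGraph (m + 2)).adjMatrix ℝ -
      (2 * Real.cos (2 * Real.pi * t / (2 * t + 1))) • (1 : Matrix (Fin (m + 2)) (Fin (m + 2)) ℝ)) := by
    have h := (PrakashEtAl2017_lemma11_holds t ht).1
    rw [show 2 * t + 1 = m + 2 from hm.symm] at h
    exact h
  set X0 : Matrix (Fin (m + 2)) (Fin (m + 2)) ℝ := (SimpleGraph.cycleGraph (m + 2)).adjMatrix ℝ -
    (2 * Real.cos (2 * Real.pi * t / (2 * t + 1))) • (1 : Matrix (Fin (m + 2)) (Fin (m + 2)) ℝ) with hX0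
  obtain ⟨δ, hδ, hgap⟩ := cycle_sub_gap m t ht hm
  rw [← hX0] at hgap
  have hX0psd : X0.PosSemidef := hX0dnn.1
  set lam : ℝ := 2 * Real.cos (2 * Real.pi * t / (2 * t + 1)) with hlam
  have hlam_lt : lam < -1 := by
    have hnpos : (0 : ℝ) < 2 * t + 1 := by positivity
    have ht2 : (2 : ℝ) ≤ t := by exact_mod_cast ht
    have hθeq : 2 * Real.pi * t / (2 * t + 1) = π - π / (2 * t + 1) := by field_simp; ring
    have hθlt : 2 * Real.pi * t / (2 * t + 1) < π := by
      rw [hθeq]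
      have : 0 < π / (2 * t + 1) := div_pos Real.pi_pos hnpos
      linarith
    have hθgt : 2 * π / 3 < 2 * Real.pi * t / (2 * t + 1) := by
      rw [hθeq, show 2 * π / 3 = π - π / 3 by ring]
      have : π / (2 * t + 1) < π / 3 := div_lt_div_of_pos_left Real.pi_pos (by norm_num) (by linarith)
      linarith
    have : Real.cos (2 * Real.pi * t / (2 * t + 1)) < Real.cos (2 * π / 3) :=
      Real.cos_lt_cos_of_nonneg_of_le_pi (by positivity) hθlt.le hθgt
    rw [show 2 * π / 3 = π - π / 3 by ring, Real.cos_pi_sub, Real.cos_pi_div_three] at this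
    rw [hlam]
    linarith
  have hX0apply : ∀ a b : Fin (m + 2), X0 a b =
      (if (SimpleGraph.cycleGraph (m + 2)).Adj a b then 1 else 0) - lam * (if a = b then 1 else 0) := by
    intro a b
    rw [hX0, Matrix.sub_apply, Matrix.smul_apply, Matrix.one_apply, SimpleGraph.adjMatrix_apply,
      smul_eq_mul]
  have hX0nn : ∀ a b, 0 ≤ X0 a b := fun a b => by
    rw [hX0apply]
    split_ifs <;> linarith
  have hX0off : ∀ a b : Fin (m + 2), a ≠ b → ¬ (SimpleGraph.cycleGraph (m + 2)).Adj a b → X0 a b = 0 := by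
    intro a b hab hadj'
    rw [hX0apply, if_neg hadj', if_neg hab]
    ring
  -- the cycle's edges are edges of `G`
  have hGf : ∀ k l : Fin (m + 2), (SimpleGraph.cycleGraph (m + 2)).Adj k l → G.Adj (f k) (f l) := by
    intro k l hkl
    rw [cycleGraph_adj_iff] at hkl
    rcases hkl with h | h
    · rw [h]; exact (hadj l).symm
    · rw [h]; exact hadj k
  -- `X̃ = Eᵀ X0 E`, `E_{k,u} = [f k = u]`
  set E : Matrix (Fin (m + 2)) ι ℝ := fun k u => if f k = u then 1 else 0 with hE
  set Xt : Matrix ι ι ℝ := Eᴴ * X0 * E with hXt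
  have hXt_apply : ∀ u v, Xt u v = ∑ l, ∑ k, (if f k = u then X0 k l else 0) * (if f l = v then 1 else 0) := by
    intro u v
    rw [hXt, Matrix.mul_apply]
    refine sum_congr rfl fun l _ => ?_
    rw [Matrix.mul_apply, Finset.sum_mul]
    refine sum_congr rfl fun k _ => ?_
    rw [conjTranspose_apply, star_trivial, hE]
    dsimp only
    split_ifs <;> simp
  have hXt_ff : ∀ k l, Xt (f k) (f l) = X0 k l := by
    intro k l
    rw [hXt_apply, Finset.sum_eq_single l, Finset.sum_eq_single k]
    · simp
    · intro k' _ hk'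
      rw [if_neg (fun h => hk' (hf h)), zero_mul]
    · intro h; exact absurd (Finset.mem_univ k) h
    · intro l' _ hl'
      rw [if_neg (fun h => hl' (hf h))]
      simp
    · intro h; exact absurd (Finset.mem_univ l) h
  have hXt_out : ∀ u v, (∀ k, f k ≠ u) → Xt u v = 0 := by
    intro u v hu
    rw [hXt_apply]
    exact sum_eq_zero fun l _ => sum_eq_zero fun k _ => by rw [if_neg (hu k), zero_mul]
  have hXt_out' : ∀ u v, (∀ l, f l ≠ v) → Xt u v = 0 := by
    intro u v hv
    rw [hXt_apply]
    exact sum_eq_zero fun l _ => sum_eq_zero fun k _ => by rw [if_neg (hv l), mul_zero]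
  have hXt_nn : ∀ u v, 0 ≤ Xt u v := by
    intro u v
    rw [hXt_apply]
    exact sum_nonneg fun l _ => sum_nonneg fun k _ => mul_nonneg
      (by split_ifs; exacts [hX0nn k l, le_rfl]) (by split_ifs <;> norm_num)
  have hXt_psd : Xt.PosSemidef := hX0psd.conjTranspose_mul_mul_same E
  -- off the edges of `G`, `X̃` vanishes
  have hXt_zero : ∀ u v, u ≠ v → ¬ G.Adj u v → Xt u v = 0 := by
    intro u v huv hnadj
    rw [hXt_apply]
    refine sum_eq_zero fun l _ => sum_eq_zero fun k _ => ?_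
    split_ifs with hk hl
    · rw [mul_one]
      have hkl : k ≠ l := fun h => huv (by rw [← hk, ← hl, h])
      exact hX0off k l hkl fun h => hnadj (by rw [← hk, ← hl]; exact hGf k l h)
    · rw [mul_zero]
    · rw [zero_mul]
    · rw [zero_mul]
  -- the perturbation
  set a : ℝ := δ / 2 with ha
  set b : ℝ := a / (Fintype.card ι + 1) with hb
  have ha0 : 0 < a := by positivity
  have hcard : (0 : ℝ) < Fintype.card ι + 1 := by positivity
  have hb0 : 0 < b := div_pos ha0 hcard
  have hba : b * Fintype.card ι ≤ a := by
    rw [hb, div_mul_eq_mul_div, div_le_iff₀ hcard]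
    linarith
  have hab : a + b ≤ δ := by
    have : b ≤ a := by
      rw [hb, div_le_iff₀ hcard]
      have : (0 : ℝ) ≤ a * Fintype.card ι := by positivity
      linarith
    linarith
  set Xa : Matrix ι ι ℝ := Xt + a • (1 : Matrix ι ι ℝ) + b • G.adjMatrix ℝ with hXa
  have hXa_apply : ∀ u v, Xa u v = Xt u v + a * (if u = v then 1 else 0) +
      b * (if G.Adj u v then 1 else 0) := by
    intro u v
    rw [hXa, Matrix.add_apply, Matrix.add_apply, Matrix.smul_apply, Matrix.smul_apply, Matrix.one_apply,
      SimpleGraph.adjMatrix_apply, smul_eq_mul, smul_eq_mul]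
  refine ⟨Xa, ⟨?_, ?_⟩, ?_, ?_⟩
  · -- psd
    have h2 : (a • (1 : Matrix ι ι ℝ) + b • G.adjMatrix ℝ).PosSemidef := by
      refine PosSemidef.of_dotProduct_mulVec_nonneg ?_ fun x => ?_
      · rw [IsHermitian, conjTranspose_add, conjTranspose_smul, conjTranspose_smul, star_trivial,
          star_trivial, conjTranspose_one, conjTranspose_eq_transpose_of_trivial,
          SimpleGraph.transpose_adjMatrix]
      · rw [star_trivial, add_mulVec, smul_mulVec, smul_mulVec, one_mulVec, dotProduct_add,
          dotProduct_smul, dotProduct_smul, smul_eq_mul, smul_eq_mul]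
        have hq := adjMatrix_quadratic_lower G x
        have hxx : x ⬝ᵥ x = ∑ u, x u ^ 2 := by
          simp only [dotProduct, sq]
        rw [hxx]
        have hs0 : 0 ≤ ∑ u, x u ^ 2 := sum_nonneg fun u _ => sq_nonneg _
        have p1 := mul_le_mul_of_nonneg_right hba hs0
        have p2 := mul_le_mul_of_nonneg_left hq hb0.le
        linarith only [p1, p2]
    rw [hXa, add_assoc]
    exact hXt_psd.add h2
  · -- entrywise nonnegative
    intro u v
    rw [hXa_apply]
    have := hXt_nn u v
    have h1 : 0 ≤ a * (if u = v then (1 : ℝ) else 0) := by split_ifs <;> nlinarith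
    have h2 : 0 ≤ b * (if G.Adj u v then (1 : ℝ) else 0) := by split_ifs <;> nlinarith
    linarith
  · -- support is exactly `G`
    intro u v huv
    rw [hXa_apply, if_neg huv, mul_zero, add_zero]
    constructor
    · intro h
      by_contra hnadj
      rw [if_neg hnadj, mul_zero, add_zero, hXt_zero u v huv hnadj] at h
      exact h rfl
    · intro h
      rw [if_pos h, mul_one]
      have := hXt_nn u v
      linarith
  · -- not cpsd: restrict a factorization to the cycle
    rintro ⟨d, P, hP, hXaP⟩
    have hY : HasCpsdFactorization (Xa.submatrix f f) d :=
      ⟨fun k => P (f k), fun k => hP (f k), fun k l => hXaP (f k) (f l)⟩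
    obtain ⟨k, l, hkl⟩ := hgap d _ hY
    have hclose : |Xa.submatrix f f k l - X0 k l| ≤ δ := by
      rw [submatrix_apply, hXa_apply, hXt_ff]
      set c1 : ℝ := (if f k = f l then (1 : ℝ) else 0) with hc1
      set c2 : ℝ := (if G.Adj (f k) (f l) then (1 : ℝ) else 0) with hc2
      have h1 : |a * c1| ≤ a := by
        rw [hc1]
        split_ifs <;> simp [abs_of_pos ha0, ha0.le]
      have h2 : |b * c2| ≤ b := by
        rw [hc2]
        split_ifs <;> simp [abs_of_pos hb0, hb0.le]
      have e : X0 k l + a * c1 + b * c2 - X0 k l = a * c1 + b * c2 := by ring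
      rw [e]
      exact ((abs_add_le _ _).trans (add_le_add h1 h2)).trans hab
    exact absurd hclose (not_le.mpr hkl)

/-- **PSVW Theorem 18, direction "⇒"** (p21: "consider a graph `G` that contains a `C_{2t+1}`-subgraph,
for some `t ≥ 2`. We show that `G` is not a cpsd-graph"): if an odd cycle on `2s+5` vertices maps
injectively into `G` along edges, then some doubly nonnegative matrix with support exactly `G` is not
completely positive semidefinite. PROVED here by the printed perturbation
`X_a = X̃ + aI + bA_G` (`thm18_core`) with the closure step supplied by the quantitative Remark 6.2
(`cycle_sub_gap`, no von Neumann algebras). The converse direction of Theorem 18 is Kogan–Berman's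
characterisation of cp-graphs [KB] plus `CP ⊆ CS_+`, see `PrakashEtAl2017_thm18_of_cpGraphs`.
[cite: PrakashEtAl2017, Thm. 18 (p21)] -/
theorem PrakashEtAl2017_thm18_mp {ι : Type} [Fintype ι] [DecidableEq ι] (G : SimpleGraph ι)
    (hcyc : ∃ (s : ℕ) (f : Fin (2 * s + 5) → ι), Function.Injective f ∧ ∀ a, G.Adj (f a) (f (a + 1))) :
    ∃ X : Matrix ι ι ℝ, IsDnn X ∧ (∀ u v, u ≠ v → (X u v ≠ 0 ↔ G.Adj u v)) ∧ ¬ IsCpsd X := by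
  obtain ⟨s, f, hf, hadj⟩ := hcyc
  exact thm18_core (2 * s + 3) (s + 2) (by omega) (by ring) G f hf hadj

/-- Theorem 18 "⇒" in the exact shape of the typed fact `PrakashEtAl2017_thm18`: a cpsd-graph has no
`C_{2t+1}`-subgraph (`t ≥ 2`). [cite: PrakashEtAl2017, Thm. 18 (p21)] -/
theorem PrakashEtAl2017_thm18_mp' {ι : Type} [Fintype ι] [DecidableEq ι] (G : SimpleGraph ι)
    (hG : ∀ X : Matrix ι ι ℝ, IsDnn X → (∀ i j, i ≠ j → (X i j ≠ 0 ↔ G.Adj i j)) → IsCpsd X) :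
    ¬ ∃ (s : ℕ) (f : Fin (2 * s + 5) → ι), Function.Injective f ∧ ∀ a, G.Adj (f a) (f (a + 1)) := by
  intro hcyc
  obtain ⟨X, hX, hsupp, hncpsd⟩ := PrakashEtAl2017_thm18_mp G hcyc
  exact hncpsd (hG X hX hsupp)

/-- **PSVW Theorem 18 modulo Kogan–Berman.** The printed proof of "⇐" is one line: "Then `G` is a
cp-graph [KB] and thus, also a cpsd-graph" (`CP ⊆ CS_+`, `HasCpFactorization.hasCpsdFactorization`).
With the Kogan–Berman characterisation of cp-graphs (N. Kogan, A. Berman, *Characterization of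
completely positive graphs*, Discrete Math. 114 (1993) 297–304: a graph with no odd cycle of length
`≥ 5` as a subgraph is completely positive, i.e. every DNN matrix with that support is CP) supplied as
the hypothesis `hKB` — it is not in the tree —, the typed fact `PrakashEtAl2017_thm18` follows from
`PrakashEtAl2017_thm18_mp'`. [cite: PrakashEtAl2017, Thm. 18 (p21)] -/
theorem PrakashEtAl2017_thm18_of_cpGraphs
    (hKB : ∀ (ι : Type) [Fintype ι] [DecidableEq ι] (G : SimpleGraph ι),
      (¬ ∃ (s : ℕ) (f : Fin (2 * s + 5) → ι), Function.Injective f ∧ ∀ a, G.Adj (f a) (f (a + 1))) →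
        ∀ X : Matrix ι ι ℝ, IsDnn X → (∀ i j, i ≠ j → (X i j ≠ 0 ↔ G.Adj i j)) → IsCp X) :
    PrakashEtAl2017_thm18 := by
  intro ι _ _ G
  constructor
  · exact PrakashEtAl2017_thm18_mp' G
  · intro hno X hX hsupp
    obtain ⟨d, hd⟩ := hKB ι G hno X hX hsupp
    exact ⟨d, hd.hasCpsdFactorization⟩

end Thm18mp

end Literature.Combinatorics.Optimization
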